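import Literature.MathematicalPhysics.QuantumFieldTheory.Balaban1983to89.B1LowerBound114Model
import Literature.MathematicalPhysics.QuantumFieldTheory.Balaban1983to89.B1Eq230FluctCovPos
import Literature.MathematicalPhysics.QuantumFieldTheory.Balaban1983to89.B1Ineq367SmallField

/-!
# `Balaban1983to89.B1Ineq368QuadForms` — T. Bałaban, *(Higgs)₂,₃ quantum fields in a finite volume. I. A lower bound*,
Commun. Math. Phys. **85** (1982) 603–626 [Balaban1982Higgs1], p. 625, the sentence between (3.67) and (3.68): *"The quatratic
forms in the exponential above are bounded, so the integral can be estimated from below by exp(−O(1)|T_ε|) with a constant O(1)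
which in general depends on L^Kε, thus on ε₀"* — PROVED for the CONCRETE quadratic forms `½⟨A, Δ^{(K),L^Kε}A⟩`, `½⟨φ, Δ^{(K),L^Kε}(0)φ⟩`
of (3.66) of the (Higgs)₂,₃ model, and threaded into the model's ledger of the lower bound (1.14) (`B1LowerBound114Model.Inputs`:
the displayed input `hQ`, the measurability fields and the radius bookkeeping DISCHARGED)

statement-level skeleton of published theorems with citation tags; proofs where landed; nothing here is a claim about the Yang–Mills mass gap

PDF held: `paper:balaban1982-cmp85-higgs23-i` (journal page = PDF page + 602); pp. 624–625 [PDF 22–23] ((3.66)–(3.68)) READ AS IMAGES on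
the ×2 renders `run/shared/lean/pub/pub-balaban/b2b-balaban-ref1/pages/1982-cmp85-higgs23-I/1982-cmp85-higgs23-I-p022-x2.png`, `…-p023-x2.png`;
p. 610 [PDF 8] ((2.17), (2.20), (2.21)) on the materialised text `~/.lit/texts/paper-balaban1982-cmp85-higgs23-i/p0008.txt`.

CITATION HEADER (lean-in-tree rule).  Cell `lit-balaban` (HOME `run/shared/lean/pub/lit-balaban/`), Phase-2 proof seat **p14** gen 11
(unit `lit-balaban-p14`; TAKING line HOME/STATUS.md 2026-08-21T20:21:43Z); SKELETON rows **B1.Eq3.68–3.69** (owner r12; coarse row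
B1.Eq3.68 r01/r14) and **B1.Thm@606** (model ledger `B1LowerBound114Model.Inputs`, this seat gen 7).  RELATION TO THE TREE (nothing
restated): the step (3.67) ⇒ (3.68) is this seat's `B1Ineq368BoxBound.ineq368_of_367` / `ineq368_model` (p253232), where the two forms of
(3.66) are ARGUMENTS `qA, qφ0` with the displayed hypothesis `hQ : 0 ≦ ½qA + ½qφ0 ≦ C₅|T_ε|` on the small-field set `S_r` of (3.67) — the
field `hQ` of `B1LowerBound114Model.Inputs` (p253966).  The operators are in the tree and USED BY NAME: `Δ^{(k),L^kε}(Ω, A)` of the scalar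
field = p35's `B1Eq230FluctCov.deltaKA C Ω A m² a k` ((2.17) at `k = 0`, the solved form (2.21) at `k ≧ 1`); of the vector field (*"N = d
and an external vector field A = 0"*, p. 608) = the typer's `HiggsFluctMeasure.deltaK P μ₀² a k` (`B1Eq230FluctCov.deltaKA_zero_field`);
positivity `B1Eq230FluctCovPos.siteInner_deltaKA_succ_pos` / `…_zero_ge` (p35); `G^ε_k(Ω, A) ≧ 0` = `HiggsCovariancePos.siteInner_propagatorK_nonneg`
(typer); the sup bound of the covariant Laplacian = this seat's `B1Ineq367SmallField.norm_covLaplacianN_univ_apply_le` (gen 8).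

WHAT IS PRINTED (verbatim).  p. 624 [PDF 22], (3.66): *"Z^ε ≧ ∫dA∫dφ χ_K(A)χ_K(φ)Z_KZ_K(0) exp[−½⟨A, Δ^{(K),L^Kε}A⟩ − ½⟨φ, Δ^{(K),L^Kε}(0)φ⟩
+ V^{(K)ε}(0, 0; A, φ) − E₀ + O(1)|T_ε|]."*; p. 625 [PDF 23]: *"Further we can estimate χ_K(A)χ_K(φ) ≧ Π_{x∈T^{(K)}_{L^Kε}} χ({|A(x)| ≦
c₁⁻¹(L^Kε)^{−(d−2)/2}p(L^Kε)})·χ({|φ(x)| ≦ c₁⁻¹(L^Kε)^{−(d−2)/2}p(L^Kε)}) […]. (3.67) The quatratic forms in the exponential above are bounded,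
so the integral can be estimated from below by exp(−O(1)|T_ε|) with a constant O(1) which in general depends on L^Kε, thus on ε₀. We get
Z^ε ≧ Z_KZ_K(0)exp(−E₀ + O(1)|T_ε|). (3.68)"*; p. 610 [PDF 8]: *"Δ^{(0),ε}(Ω, A) = −Δ^{ε,N}_{A,Ω} + m², (2.17)"*, *"⟨ψ, Δ^{(k),L^kε}(Ω, A)ψ⟩ =
a_k(L^kε)^{−2}⟨ψ,ψ⟩ − a_k²(L^kε)^{−4}⟨ψ, Q_k(A)G^ε_k(Ω, A)Q_k^*(A)ψ⟩. (2.21)"*.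
THE ARGUMENT (left to the reader in print).  By (2.21) and `G^ε_k(Ω, A) ≧ 0`: `⟨ψ, Δ^{(k),L^kε}(Ω, A)ψ⟩ ≦ a_k(L^kε)^{−2}⟨ψ, ψ⟩` (`k ≧ 1`, every
`Ω`, `A`); by (2.17) and `|(Δ^ε_Aφ)(x)| ≦ 4dε^{−2}sup|φ|`: `⟨φ, Δ^{(0),ε}(T_ε, A)φ⟩ ≦ (4dε^{−2} + m²)·sup|φ|²·|T_ε|`; both forms are `≧ 0`
(p. 611).  On `S_r` (`|A(x)|, |φ(x)| ≦ r`), `⟨ψ, ψ⟩ = Σ_{x∈T^{(K)}}(L^Kε)^d|ψ(x)|² ≦ r²|T^{(K)}|(L^Kε)^d = r²|T_ε|` ((1.21)), whence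
`0 ≦ ½⟨A, Δ^{(K)}A⟩ + ½⟨φ, Δ^{(K)}(0)φ⟩ ≦ ½(b_K(μ₀²) + b_K(m²))·r²·|T_ε|`, `b_K(m²) = a_K(L^Kε)^{−2}` (`K ≧ 1`), `4dε^{−2} + m²` (`K = 0`); with the
stopping rule `L^Kε ≦ ε₀ < L^{K+1}ε` (p. 624: `ε₀/L < L^Kε`) and `a_K ≦ a` ((2.15)) this is `≦ ((4d + a)(L/ε₀)² + ½(μ₀² + m²))·r²`, ε-FREE.

WHAT THIS FILE PROVES (kernel-checked, zero `sorry`; axioms standard).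
* §1 `siteInner_QGQ_nonneg`, **`siteInner_deltaKA_succ_le`** (`⟨ψ, Δ^{(k),L^kε}(Ω,A)ψ⟩ ≦ a_k(L^kε)^{−2}⟨ψ,ψ⟩`, `k ≧ 1`, every `Ω, A, C`,
  `m² > 0`), `siteInner_deltaKA_succ_nonneg`, `siteInner_deltaKA_zero_nonneg`, `siteInner_le_of_norm_le`, `siteInner_deltaKA_zero_le`
  (`⟨φ, Δ^{(0),ε}(T_ε,A)φ⟩ ≦ (4dε^{−2} + m²)r²|T_ε|`), the scale function `formBound` (`b_k(m²)`) and **`form_sandwich`**: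
  `0 ≦ ⟨ψ, Δ^{(k),L^kε}(T_ε,A)ψ⟩ ≦ b_k(m²)·r²·|T_ε|` for `sup|ψ| ≦ r`, every `k ≦ K` of (1.2), every `A`.
* §2 the CONCRETE FORMS OF (3.66) `qVec P μ₀² a K A = ⟨A, Δ^{(K),L^Kε}A⟩`, `qScal C m² a K φ = ⟨φ, Δ^{(K),L^Kε}(0)φ⟩` (continuous, measurable)
  and **`forms_bound`** — THE SENTENCE: on `S_r` (`B1Ineq368BoxBound.smallSet`), `0 ≦ ½qVec + ½qScal ≦ ½(b_K(μ₀²) + b_K(m²))·r²·|T_ε|`.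
* §3 `inv_mesh_sq_le_of_stop`, `formBound_le_of_stop`, the ε-independent `c5Unif d L a μ₀² m² ε₀ r = ((4d + a)(L/ε₀)² + ½(μ₀² + m²))r²` and
  **`forms_bound_of_stop`**: `0 ≦ ½qVec + ½qScal ≦ c5Unif·|T_ε|` on `S_r` under the stopping rule — the `O(1)` *"thus on ε₀"*.
* §4 the ledger: `PreInputs D U P` = `B1LowerBound114Model.Inputs` WITHOUT the form data (`qA, qφ0, hqAm, hqφm, hQ`) and the per-lattice
  radius (`r := r₀` of `Consts`), (E1) of Prop. 3.1 stated for the CONCRETE forms; **`PreInputs.toInputs`** (given `c5Unif ≦ C₅`);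
  **`lowerBoundWith_cutoffFamily_of_preInputs`**, `lowerBoundPrinted_cutoffFamily_of_preInputs`, `lowerBound114_of_preInputs`: the lower
  half of (1.14) for the concrete cutoff family with ONE constant `E₋ = U.eMinus D`, from the pre-inputs on every admissible lattice.
HONEST SCOPE.  Proved here: only the non-negativity and boundedness of the two quadratic forms of (3.66) on the small-field set, constants
explicit, and the bookkeeping removing them from the displayed inputs of the model's lower bound.  NOT proved here (fields of `PreInputs`,
displayed exactly as in `Inputs`): the (3.26) step bound `h360` (Props. 3.1/3.2, (3.38)–(3.60)), (E1) of Prop. 3.1 at `k = K`, (E2)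
`|V^{(K),ε}| ≦ C₂|T_ε|`, (E3) `χ_K = 1` on `S_{r₀}` (this seat's `B1Ineq367SmallField(Torus)`: unconditional at `K = 0`; at `K ≧ 1` on the torus
sub-family modulo the scalar propagator bound with background field), the (3.69) conjunct (p12's `B1Eq369GaussRatio` for its carriers).
`m² > 0`, `μ₀² > 0` (p. 605), `a > 0`, `L > 1` are hypotheses; `K ≦` the `K` of (1.2).  Nothing here is summit progress.
-/

open scoped BigOperators InnerProductSpace
open _root_.MeasureTheory

namespace Literature.MathematicalPhysics.QuantumFieldTheory.Balaban1983to89.B1Ineq368QuadForms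

open HiggsLattice HiggsCovariance HiggsCovariancePos HiggsCovarianceCont HiggsFluctMeasure HiggsFluctMeasurePos HiggsDoubleRT
  B3MultiscaleFields B1Eq230FluctCov B1Eq230FluctCovPos B1Ineq368BoxBound B1LowerBound114Model B1Sect1Statements
open B1Ineq326HiggsModel (chiW extW)
open B1Ineq367SmallField (norm_covLaplacianN_univ_apply_le)

variable {P : HiggsLattice.Params} {N : ℕ}

/-! ## §1 `0 ≦ Δ^{(k),L^kε}(Ω, A) ≦ a_k(L^kε)^{−2}` as quadratic forms ((2.21) with `G^ε_k(Ω, A) ≧ 0`; (2.17)) -/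

section Sandwich

variable (C : ChargeData N) (Ω : Finset (HiggsLattice.Site P 0)) (A : HiggsLattice.VecField P 0)

/-- `⟨ψ, Q_k(A)G^ε_k(Ω,A)Q_k^*(A)ψ⟩ = ⟨G^ε_k(Ω,A)Q_k^*(A)ψ, Q_k^*(A)ψ⟩ ≧ 0` — the subtracted term of (2.21) is non-negative
(`Q_k^*(A)` is the adjoint of `Q_k(A)` for (1.5), (2.20); `G^ε_k(Ω, A) ≧ 0`, `m² > 0`). [cite: Balaban1982Higgs1, (2.21) p.610; (2.20) p.610] -/
theorem siteInner_QGQ_nonneg {msq : ℝ} (hmsq : 0 < msq) (a : ℝ) (k : ℕ) (hak : 0 ≤ B1.aSeq a P.L k)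
    (ψ : HiggsLattice.ScalarField P k N) :
    0 ≤ siteInner ψ (avgQkLin C A k (propagatorK C Ω A msq a k (avgQkAdj C A k ψ))) := by
  rw [siteInner_comm, siteInner_avgQkLin]
  exact siteInner_propagatorK_nonneg C Ω A hmsq a k hak _

/-- **`⟨ψ, Δ^{(k),L^kε}(Ω, A)ψ⟩ ≦ a_k(L^kε)^{−2}⟨ψ, ψ⟩` for `k ≧ 1`**, every region `Ω`, external field `A` and coupling `C`
(`m² > 0`): the solved form (2.21) minus a non-negative term. [cite: Balaban1982Higgs1, (2.21) p.610] -/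
theorem siteInner_deltaKA_succ_le {msq : ℝ} (hmsq : 0 < msq) (a : ℝ) (j : ℕ) (hak : 0 ≤ B1.aSeq a P.L (j + 1))
    (ψ : HiggsLattice.ScalarField P (j + 1) N) :
    siteInner ψ (deltaKA C Ω A msq a (j + 1) ψ) ≤ coeff221 P a (j + 1) * siteInner ψ ψ := by
  rw [siteInner_deltaKA_succ]
  exact sub_le_self _ (mul_nonneg (sq_nonneg _) (siteInner_QGQ_nonneg C Ω A hmsq a (j + 1) hak ψ))

/-- `⟨ψ, Δ^{(k),L^kε}(Ω, A)ψ⟩ ≧ 0` for `1 ≦ k ≦ K` (`m² > 0`, `a > 0`, `L > 1`; strictly positive for `ψ ≠ 0`, p. 611 —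
`B1Eq230FluctCovPos.siteInner_deltaKA_succ_pos`). [cite: Balaban1982Higgs1, (2.21) p.610; (2.33) p.611] -/
theorem siteInner_deltaKA_succ_nonneg {msq a : ℝ} (hmsq : 0 < msq) (ha : 0 < a) (hL : 1 < (P.L : ℝ)) {j : ℕ}
    (hj : j + 1 ≤ P.K) (ψ : HiggsLattice.ScalarField P (j + 1) N) : 0 ≤ siteInner ψ (deltaKA C Ω A msq a (j + 1) ψ) := by
  by_cases hψ : ψ = 0
  · rw [hψ, map_zero]
    simp [siteInner]
  · exact (siteInner_deltaKA_succ_pos C Ω A hmsq ha hL hj hψ).le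

/-- `⟨φ, Δ^{(0),ε}(Ω, A)φ⟩ ≧ m²⟨φ, φ⟩ ≧ 0` ((2.17): `−Δ^{ε,N}_{A,Ω} ≧ 0`, `m² ≧ 0`). [cite: Balaban1982Higgs1, (2.17) p.610] -/
theorem siteInner_deltaKA_zero_nonneg {msq : ℝ} (hmsq : 0 ≤ msq) (a : ℝ) (f : HiggsLattice.ScalarField P 0 N) :
    0 ≤ siteInner f (deltaKA C Ω A msq a 0 f) :=
  (mul_nonneg hmsq (siteInner_self_nonneg f)).trans (siteInner_deltaKA_zero_ge C Ω A msq a f)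

/-- `⟨f, g⟩ = Σ_x η^d f(x)·g(x) ≦ sup|f|·sup|g|·|T^{(j)}|`, `|T^{(j)}| = η^d·#T^{(j)}` ((1.5), (1.21)). [cite: Balaban1982Higgs1, (1.5) p.604; (1.21) p.607] -/
theorem siteInner_le_of_norm_le {j M : ℕ} {f g : HiggsLattice.ScalarField P j M} {r s : ℝ} (hf : ∀ x, ‖f x‖ ≤ r)
    (hg : ∀ x, ‖g x‖ ≤ s) : siteInner f g ≤ r * s * P.vol j Finset.univ := by
  have hr : 0 ≤ r := (norm_nonneg _).trans (hf default)
  unfold siteInner HiggsLattice.Params.vol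
  calc ∑ x, P.mesh j ^ P.d * ⟪f x, g x⟫_ℝ ≤ ∑ _x : HiggsLattice.Site P j, P.mesh j ^ P.d * (r * s) :=
        Finset.sum_le_sum fun x _ => mul_le_mul_of_nonneg_left
          ((real_inner_le_norm _ _).trans (mul_le_mul (hf x) (hg x) (norm_nonneg _) hr))
          (pow_nonneg (P.mesh_pos j).le _)
    _ = r * s * (P.mesh j ^ P.d * (Finset.univ.card : ℝ)) := by
        rw [Finset.sum_const, nsmul_eq_mul]
        ring

/-- **`⟨φ, Δ^{(0),ε}(T_ε, A)φ⟩ ≦ (4dε^{−2} + m²)·r²·|T_ε|` when `|φ(x)| ≦ r` at every site** ((2.17) with the sup bound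
`|(Δ^ε_Aφ)(x)| ≦ 4dε^{−2}sup|φ|` of the covariant Laplacian on the whole torus, every `A`; `m² ≧ 0`). [cite: Balaban1982Higgs1, (2.17) p.610; (1.11) p.605] -/
theorem siteInner_deltaKA_zero_le {msq : ℝ} (hmsq : 0 ≤ msq) (a : ℝ) {f : HiggsLattice.ScalarField P 0 N} {r : ℝ}
    (hf : ∀ x, ‖f x‖ ≤ r) :
    siteInner f (deltaKA C Finset.univ A msq a 0 f) ≤ (4 * P.d * (P.mesh 0)⁻¹ ^ 2 + msq) * r ^ 2 * P.vol 0 Finset.univ := by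
  rw [deltaKA_zero, delta0, LinearMap.add_apply, LinearMap.smul_apply, LinearMap.id_apply, siteInner_add_right,
    siteInner_smul_right]
  have h1 : siteInner f (covLaplacianN C Finset.univ A f) ≤ r * (4 * P.d * (P.mesh 0)⁻¹ ^ 2 * r) * P.vol 0 Finset.univ :=
    siteInner_le_of_norm_le hf (norm_covLaplacianN_univ_apply_le C A f hf)
  have h2 : siteInner f f ≤ r * r * P.vol 0 Finset.univ := siteInner_le_of_norm_le hf hf
  have h3 := mul_le_mul_of_nonneg_left h2 hmsq
  calc siteInner f (covLaplacianN C Finset.univ A f) + msq * siteInner f f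
      ≤ r * (4 * P.d * (P.mesh 0)⁻¹ ^ 2 * r) * P.vol 0 Finset.univ + msq * (r * r * P.vol 0 Finset.univ) := add_le_add h1 h3
    _ = (4 * P.d * (P.mesh 0)⁻¹ ^ 2 + msq) * r ^ 2 * P.vol 0 Finset.univ := by ring

/-- **The scale function `b_k(m²)` of the bound**: `b_0(m²) = 4dε^{−2} + m²` ((2.17)), `b_k(m²) = a_k(L^kε)^{−2}` for `k ≧ 1` ((2.21),
`HiggsFluctMeasure.coeff221`) — a constant *"which in general depends on L^Kε"* (p. 625). [cite: Balaban1982Higgs1, (2.21) p.610; (3.68) p.625] -/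
noncomputable def formBound (P : HiggsLattice.Params) (msq a : ℝ) : ℕ → ℝ
  | 0 => 4 * P.d * (P.mesh 0)⁻¹ ^ 2 + msq
  | k + 1 => coeff221 P a (k + 1)

/-- `b_0(m²) = 4dε^{−2} + m²`. [cite: Balaban1982Higgs1, (2.17) p.610] -/
theorem formBound_zero (msq a : ℝ) : formBound P msq a 0 = 4 * P.d * (P.mesh 0)⁻¹ ^ 2 + msq := rfl

/-- `b_{k+1}(m²) = a_{k+1}(L^{k+1}ε)^{−2}`. [cite: Balaban1982Higgs1, (2.21) p.610] -/
theorem formBound_succ (msq a : ℝ) (k : ℕ) : formBound P msq a (k + 1) = coeff221 P a (k + 1) := rfl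

/-- `b_k(m²) ≧ 0` (`m² ≧ 0`, `a > 0`, `L > 1`). [cite: Balaban1982Higgs1, (2.21) p.610] -/
theorem formBound_nonneg {msq a : ℝ} (hmsq : 0 ≤ msq) (ha : 0 < a) (hL : 1 < (P.L : ℝ)) :
    ∀ k : ℕ, 0 ≤ formBound P msq a k
  | 0 => by
      rw [formBound_zero]
      positivity
  | k + 1 => (coeff221_pos ha hL (Nat.succ_le_succ (Nat.zero_le k))).le

/-- **`0 ≦ ⟨ψ, Δ^{(k),L^kε}(T_ε, A)ψ⟩ ≦ b_k(m²)·r²·|T_ε|` whenever `|ψ(x)| ≦ r` at every site of `T^{(k)}_{L^kε}`**, for every `k ≦ K`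
of (1.2), every external field `A` and coupling `C` (`m² > 0`, `a > 0`, `L > 1`; `|T^{(k)}|(L^kε)^d = |T_ε|`, (1.21)) — the two members of
*"The quatratic forms in the exponential above are bounded"* for one form. [cite: Balaban1982Higgs1, (3.68) p.625; (2.21) p.610; (2.17) p.610] -/
theorem form_sandwich {msq a : ℝ} (hmsq : 0 < msq) (ha : 0 < a) (hL : 1 < (P.L : ℝ)) :
    ∀ {k : ℕ}, k ≤ P.K → ∀ {ψ : HiggsLattice.ScalarField P k N} {r : ℝ}, (∀ x, ‖ψ x‖ ≤ r) →
      0 ≤ siteInner ψ (deltaKA C Finset.univ A msq a k ψ) ∧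
        siteInner ψ (deltaKA C Finset.univ A msq a k ψ) ≤ formBound P msq a k * r ^ 2 * P.vol 0 Finset.univ
  | 0, _, ψ, r, hψ =>
      ⟨siteInner_deltaKA_zero_nonneg C Finset.univ A hmsq.le a ψ, siteInner_deltaKA_zero_le C A hmsq.le a hψ⟩
  | k + 1, hk, ψ, r, hψ => by
      have hk1 : 1 ≤ k + 1 := Nat.succ_le_succ (Nat.zero_le k)
      have hak : 0 ≤ B1.aSeq a P.L (k + 1) := (B1.aSeq_pos ha hL hk1).le
      refine ⟨siteInner_deltaKA_succ_nonneg C Finset.univ A hmsq ha hL hk ψ, ?_⟩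
      have h1 := siteInner_deltaKA_succ_le C Finset.univ A hmsq a k hak ψ
      have h2 : siteInner ψ ψ ≤ r * r * P.vol (k + 1) Finset.univ := siteInner_le_of_norm_le hψ hψ
      rw [vol_univ_eq hk] at h2
      rw [formBound_succ]
      calc siteInner ψ (deltaKA C Finset.univ A msq a (k + 1) ψ) ≤ coeff221 P a (k + 1) * siteInner ψ ψ := h1
        _ ≤ coeff221 P a (k + 1) * (r * r * P.vol 0 Finset.univ) :=
          mul_le_mul_of_nonneg_left h2 (coeff221_pos ha hL hk1).le
        _ = coeff221 P a (k + 1) * r ^ 2 * P.vol 0 Finset.univ := by ring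

end Sandwich

/-! ## §2 The two quadratic forms of (3.66) and the sentence of p. 625 -/

section Forms

/-- **`⟨A, Δ^{(K),L^Kε}A⟩`, the vector-field quadratic form of (3.66)**: the operator `Δ^{(K),L^Kε}` of the vector field — *"The
renormalization transformations for vector fields will be obtained by taking N = d and an external vector field A = 0"* (p. 608),
mass `μ₀²` ((1.11)) — is the typer's `HiggsFluctMeasure.deltaK P μ₀² a K`, acting on the vector field read as an `ℝ^d`-valued site function
(`B3MultiscaleFields.toSite`, p. 608); scalar product (1.5) on `T^{(K)}_{L^Kε}`. [cite: Balaban1982Higgs1, (3.66) p.624; (2.21) p.610] -/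
noncomputable def qVec (P : HiggsLattice.Params) (mu0sq a : ℝ) (K : ℕ) (A : HiggsLattice.VecField P K) : ℝ :=
  siteInner (toSite A) (HiggsFluctMeasure.deltaK P mu0sq a K (toSite A))

/-- **`⟨φ, Δ^{(K),L^Kε}(0)φ⟩`, the scalar-field quadratic form of (3.66)**: the operator `Δ^{(K),L^Kε}(0) = Δ^{(K),L^Kε}(T_ε, 0)` at the
ZERO external field, mass `m²`, coupling `C` of the model (p35's `B1Eq230FluctCov.deltaKA C T_ε 0 m² a K`). [cite: Balaban1982Higgs1, (3.66) p.624; (2.21) p.610] -/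
noncomputable def qScal (C : ChargeData N) (msq a : ℝ) (K : ℕ) (φ : HiggsLattice.ScalarField P K N) : ℝ :=
  siteInner φ (deltaKA C Finset.univ (0 : HiggsLattice.VecField P 0) msq a K φ)

/-- The vector form is the scalar form at the trivial coupling `N = d`, `A = 0` (`B1Eq230FluctCov.deltaKA_zero_field`).
[cite: Balaban1982Higgs1, p.608; (2.21) p.610] -/
theorem qVec_eq_deltaKA (mu0sq a : ℝ) (K : ℕ) (A : HiggsLattice.VecField P K) :
    qVec P mu0sq a K A = siteInner (toSite A) (deltaKA (zeroCharge P.d) Finset.univ (0 : HiggsLattice.VecField P 0) mu0sq a K (toSite A)) := by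
  rw [qVec, deltaKA_zero_field]

/-- `A ↦ ⟨A, Δ^{(K),L^Kε}A⟩` is continuous (a quadratic form on a finite-dimensional space). [cite: Balaban1982Higgs1, (3.66) p.624] -/
theorem continuous_qVec (mu0sq a : ℝ) (K : ℕ) : Continuous (qVec P mu0sq a K) :=
  continuous_siteInner continuous_toSite ((LinearMap.continuous_of_finiteDimensional _).comp continuous_toSite)

/-- `A ↦ ⟨A, Δ^{(K),L^Kε}A⟩` is measurable. [cite: Balaban1982Higgs1, (3.66) p.624] -/
theorem measurable_qVec (mu0sq a : ℝ) (K : ℕ) : Measurable (qVec P mu0sq a K) :=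
  (continuous_qVec mu0sq a K).measurable

/-- `φ ↦ ⟨φ, Δ^{(K),L^Kε}(0)φ⟩` is continuous. [cite: Balaban1982Higgs1, (3.66) p.624] -/
theorem continuous_qScal (C : ChargeData N) (msq a : ℝ) (K : ℕ) : Continuous (qScal (P := P) C msq a K) :=
  continuous_siteInner continuous_id (LinearMap.continuous_of_finiteDimensional _)

/-- `φ ↦ ⟨φ, Δ^{(K),L^Kε}(0)φ⟩` is measurable. [cite: Balaban1982Higgs1, (3.66) p.624] -/
theorem measurable_qScal (C : ChargeData N) (msq a : ℝ) (K : ℕ) : Measurable (qScal (P := P) C msq a K) :=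
  (continuous_qScal C msq a K).measurable

/-- **THE SENTENCE *"The quatratic forms in the exponential above are bounded"*** (p. 625) FOR THE FORMS OF (3.66): on the small-field set
`S_r = {|A(x)| ≦ r, |φ(x)| ≦ r ∀x ∈ T^{(K)}_{L^Kε}}` of (3.67) (`B1Ineq368BoxBound.smallSet`), for every `K ≦` the `K` of (1.2),
`0 ≦ ½⟨A, Δ^{(K),L^Kε}A⟩ + ½⟨φ, Δ^{(K),L^Kε}(0)φ⟩ ≦ ½(b_K(μ₀²) + b_K(m²))·r²·|T_ε|` (`m², μ₀² > 0`, `a > 0`, `L > 1`) — the displayed input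
`hQ` of `B1Ineq368BoxBound.ineq368_model` / `B1LowerBound114Model.Inputs` with `C₅ = ½(b_K(μ₀²) + b_K(m²))r²`, a constant *"which in general
depends on L^Kε"*. [cite: Balaban1982Higgs1, (3.68) p.625; (3.66) p.624] -/
theorem forms_bound (C : ChargeData N) {mu0sq msq a : ℝ} (hmu : 0 < mu0sq) (hmsq : 0 < msq) (ha : 0 < a) (hL : 1 < (P.L : ℝ))
    {K : ℕ} (hK : K ≤ P.K) {r : ℝ} :
    ∀ ω ∈ smallSet P N K r,
      0 ≤ qVec P mu0sq a K ω.1 / 2 + qScal C msq a K ω.2 / 2 ∧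
        qVec P mu0sq a K ω.1 / 2 + qScal C msq a K ω.2 / 2
          ≤ (formBound P mu0sq a K + formBound P msq a K) / 2 * r ^ 2 * P.vol 0 Finset.univ := by
  rintro ⟨A, φ⟩ ⟨hA, hφ⟩
  have hv := form_sandwich (zeroCharge P.d) (0 : HiggsLattice.VecField P 0) hmu ha hL hK (ψ := toSite A) hA
  have hs := form_sandwich C (0 : HiggsLattice.VecField P 0) hmsq ha hL hK (ψ := φ) hφ
  rw [← qVec_eq_deltaKA] at hv
  change 0 ≤ qVec P mu0sq a K A / 2 + qScal C msq a K φ / 2 ∧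
    qVec P mu0sq a K A / 2 + qScal C msq a K φ / 2 ≤ (formBound P mu0sq a K + formBound P msq a K) / 2 * r ^ 2 * P.vol 0 Finset.univ
  unfold qScal
  constructor
  · linarith [hv.1, hs.1]
  · linarith [hv.2, hs.2]

end Forms

/-! ## §3 *"… with a constant O(1) which in general depends on L^Kε, thus on ε₀"*: uniformity under the stopping rule -/

section Uniform

/-- Under the stopping rule `ε₀ < L^{K+1}ε` (p. 624) the last mesh is bounded below, `ε₀/L < L^Kε`, so `(L^Kε)^{−2} ≦ (L/ε₀)²`.
[cite: Balaban1982Higgs1, p.624 (before (3.66)); (1.19) p.607] -/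
theorem inv_mesh_sq_le_of_stop {ε₀ : ℝ} (hε₀ : 0 < ε₀) {K : ℕ} (hstop : ε₀ < P.mesh (K + 1)) :
    (P.mesh K)⁻¹ ^ 2 ≤ ((P.L : ℝ) / ε₀) ^ 2 := by
  have hL : (0 : ℝ) < P.L := by exact_mod_cast P.hL
  have hm := mesh_gt_of_stop (P := P) hstop
  have hq : 0 < ε₀ / P.L := div_pos hε₀ hL
  have h1 : (P.mesh K)⁻¹ ≤ (ε₀ / P.L)⁻¹ := (inv_le_inv₀ (P.mesh_pos K) hq).2 hm.le
  rw [inv_div] at h1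
  exact pow_le_pow_left₀ (inv_nonneg.2 (P.mesh_pos K).le) h1 2

/-- **`b_K(m²) ≦ (4d + a)(L/ε₀)² + m²` under the stopping rule** (`a_K ≦ a`, (2.15); `ε₀/L < L^Kε`): the constant no longer depends on `ε`.
[cite: Balaban1982Higgs1, (3.68) p.625; (2.15) p.609; p.624 (before (3.66))] -/
theorem formBound_le_of_stop {msq a : ℝ} (hmsq : 0 ≤ msq) (ha : 0 < a) (hL : 1 < (P.L : ℝ)) {ε₀ : ℝ} (hε₀ : 0 < ε₀) :
    ∀ {K : ℕ}, ε₀ < P.mesh (K + 1) → formBound P msq a K ≤ (4 * P.d + a) * ((P.L : ℝ) / ε₀) ^ 2 + msq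
  | 0, hstop => by
      rw [formBound_zero]
      have h := inv_mesh_sq_le_of_stop (P := P) hε₀ hstop
      have hd : (0 : ℝ) ≤ 4 * P.d := by positivity
      nlinarith [mul_le_mul_of_nonneg_left h hd, mul_nonneg ha.le (sq_nonneg ((P.L : ℝ) / ε₀))]
  | K + 1, hstop => by
      rw [formBound_succ, coeff221_eq]
      have h := inv_mesh_sq_le_of_stop (P := P) hε₀ hstop
      have hK1 : 1 ≤ K + 1 := Nat.succ_le_succ (Nat.zero_le K)
      have hale : B1.aSeq a P.L (K + 1) ≤ a := B1.aSeq_le ha hL (K + 1) hK1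
      have hapos : 0 ≤ B1.aSeq a P.L (K + 1) := (B1.aSeq_pos ha hL hK1).le
      have hd : (0 : ℝ) ≤ 4 * P.d := by positivity
      calc B1.aSeq a P.L (K + 1) * (P.mesh (K + 1))⁻¹ ^ 2 ≤ a * ((P.L : ℝ) / ε₀) ^ 2 :=
            mul_le_mul hale h (sq_nonneg _) ha.le
        _ ≤ (4 * P.d + a) * ((P.L : ℝ) / ε₀) ^ 2 + msq := by
            nlinarith [mul_nonneg hd (sq_nonneg ((P.L : ℝ) / ε₀))]

/-- **The ε-INDEPENDENT constant `C₅`** of the sentence: `c5Unif d L a μ₀² m² ε₀ r = ((4d + a)(L/ε₀)² + ½(μ₀² + m²))·r²` — a function of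
the model data, of the constants `a, ε₀` chosen before the lattice and of the radius only (*"thus on ε₀"*). [cite: Balaban1982Higgs1, (3.68) p.625] -/
noncomputable def c5Unif (d L : ℕ) (a mu0sq msq ε₀ r : ℝ) : ℝ :=
  ((4 * d + a) * ((L : ℝ) / ε₀) ^ 2 + (mu0sq + msq) / 2) * r ^ 2

/-- **THE SENTENCE WITH ITS ε-INDEPENDENT CONSTANT**: under the stopping rule `ε₀ < L^{K+1}ε` of p. 624, on the small-field set `S_r` of
(3.67), `0 ≦ ½⟨A, Δ^{(K),L^Kε}A⟩ + ½⟨φ, Δ^{(K),L^Kε}(0)φ⟩ ≦ c5Unif(d, L, a, μ₀², m², ε₀, r)·|T_ε|` for every `K ≦` the `K` of (1.2) — *"a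
constant O(1) which in general depends on L^Kε, thus on ε₀"*. [cite: Balaban1982Higgs1, (3.68) p.625; p.624 (before (3.66))] -/
theorem forms_bound_of_stop (C : ChargeData N) {mu0sq msq a : ℝ} (hmu : 0 < mu0sq) (hmsq : 0 < msq) (ha : 0 < a)
    (hL : 1 < (P.L : ℝ)) {K : ℕ} (hK : K ≤ P.K) {ε₀ : ℝ} (hε₀ : 0 < ε₀) (hstop : ε₀ < P.mesh (K + 1)) {r : ℝ} :
    ∀ ω ∈ smallSet P N K r,
      0 ≤ qVec P mu0sq a K ω.1 / 2 + qScal C msq a K ω.2 / 2 ∧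
        qVec P mu0sq a K ω.1 / 2 + qScal C msq a K ω.2 / 2 ≤ c5Unif P.d P.L a mu0sq msq ε₀ r * P.vol 0 Finset.univ := by
  intro ω hω
  have h := forms_bound C hmu hmsq ha hL hK (r := r) ω hω
  refine ⟨h.1, h.2.trans (mul_le_mul_of_nonneg_right ?_ (volT_nonneg P))⟩
  have h1 := formBound_le_of_stop (P := P) hmu.le ha hL hε₀ hstop
  have h2 := formBound_le_of_stop (P := P) hmsq.le ha hL hε₀ hstop
  unfold c5Unif
  exact mul_le_mul_of_nonneg_right (by linarith) (sq_nonneg r)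

end Uniform

/-! ## §4 The model's ledger of (1.14) with the forms of (3.66) concrete and `hQ` discharged -/

section Ledger

/-- **The displayed inputs of Sects. 2–3 on ONE lattice, the quadratic forms of (3.66) being the CONCRETE ones** — the structure
`B1LowerBound114Model.Inputs` without its form data `qA, qφ0, hqAm, hqφm, hQ` (now theorems: §2–§3) and without the per-lattice radius
(`r := r₀` of `B1LowerBound114Model.Consts`): the stopping scale `K` with `L^Kε ≦ ε₀ < L^{K+1}ε` (p. 624), thresholds `(ℓ_k, p_k)`, effective actions `S^{(k)}`
with `S^{(0)} = S^ε` and `exp(−S^{(k)}) ∈ L¹`, the induction (3.26) step bound `h360` ((3.38) with (3.51), (3.55), (3.60)), the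
interaction `V^{(K),ε}` and the normalisations `Z_K, Z_K(0), E₀` of (3.66) with (E1) the expansion of Prop. 3.1 on the support of `χ_K` —
NOW FOR `½⟨A, Δ^{(K),L^Kε}A⟩ = ½qVec`, `½⟨φ, Δ^{(K),L^Kε}(0)φ⟩ = ½qScal` —, (E2) `|V^{(K),ε}| ≦ C₂|T_ε|` (Prop. 3.2), (E3) `χ_K = 1` on the
small-field set `S_{r₀}` of (3.67), and the (3.69) conjunct. [cite: Balaban1982Higgs1, (3.66) p.624; (3.26) p.617; (3.67)–(3.69) p.625] -/
structure PreInputs (D : ModelData) (U : B1LowerBound114Model.Consts) (P : HiggsLattice.Params) where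
  K : ℕ
  hKP : K ≤ P.K
  hKε : P.mesh K ≤ U.ε₀
  hstop : U.ε₀ < P.mesh (K + 1)
  ℓ : ℕ → ℝ
  p : ℕ → ℝ
  S : (k : ℕ) → HiggsLattice.VecField P k → HiggsLattice.ScalarField P k D.N → ℝ
  h0 : S 0 = action D.C (couplings D P)
  hS : ∀ k, k ≤ K → Integrable fun Φ : HiggsLattice.VecField P k × HiggsLattice.ScalarField P k D.N => Real.exp (-S k Φ.1 Φ.2)
  h360 : ∀ k, k < K → ∀ (B : HiggsLattice.VecField P (k + 1)) (ψ : HiggsLattice.ScalarField P (k + 1) D.N),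
    chiW D.C ℓ p D.mu0sq D.msq U.a (k + 1) B ψ ≠ 0 →
      Real.exp (-S (k + 1) B ψ) * Real.exp (-(U.Cst * P.mesh k ^ U.κ₀ * P.vol 0 Finset.univ))
        ≤ doubleRTk D.C U.a (extW D.mu0sq U.a k) (fun A φ => chiW D.C ℓ p D.mu0sq D.msq U.a k A φ * Real.exp (-S k A φ)) B ψ
  V : HiggsLattice.VecField P K × HiggsLattice.ScalarField P K D.N → ℝ
  ZK : ℝ
  ZK0 : ℝ
  E₀ : ℝ
  hZK : 0 ≤ ZK
  hZK0 : 0 ≤ ZK0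
  hE1 : ∀ ω : HiggsLattice.VecField P K × HiggsLattice.ScalarField P K D.N, chiW D.C ℓ p D.mu0sq D.msq U.a K ω.1 ω.2 ≠ 0 →
    ZK * ZK0 * Real.exp (-(qVec P D.mu0sq U.a K ω.1) / 2 - qScal D.C D.msq U.a K ω.2 / 2 + V ω - E₀
      - U.C₁ * P.vol 0 Finset.univ) ≤ Real.exp (-S K ω.1 ω.2)
  hE2 : ∀ ω : HiggsLattice.VecField P K × HiggsLattice.ScalarField P K D.N, chiW D.C ℓ p D.mu0sq D.msq U.a K ω.1 ω.2 ≠ 0 →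
    |V ω| ≤ U.C₂ * P.vol 0 Finset.univ
  hE3 : ∀ ω ∈ smallSet P D.N K U.r₀, chiW D.C ℓ p D.mu0sq D.msq U.a K ω.1 ω.2 = 1
  h369 : Real.exp (-U.C₆ * P.vol 0 Finset.univ) ≤ ZK * ZK0 * Real.exp (-E₀)

/-- **`hQ` DISCHARGED**: the pre-inputs on a lattice with the model's `L` give the full `B1LowerBound114Model.Inputs` — the forms of (3.66)
concrete (`qA = qVec`, `qφ0 = qScal`, measurable), the small-field set at the radius `r₀`, and `0 ≦ ½qA + ½qφ0 ≦ C₅|T_ε|` there by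
`forms_bound_of_stop`, provided the constant `C₅` chosen before the lattice dominates `c5Unif(d, L, a, μ₀², m², ε₀, r₀)` (`m², μ₀² > 0`, p. 605).
[cite: Balaban1982Higgs1, (3.68) p.625; (3.66) p.624; Theorem (1.14) p.606] -/
noncomputable def PreInputs.toInputs {D : ModelData} {U : B1LowerBound114Model.Consts} {P : HiggsLattice.Params} (X : PreInputs D U P) (hm : 0 < D.msq)
    (hmu : 0 < D.mu0sq) (hPd : P.d = D.d) (hPL : P.L = D.L) (hL : 1 < D.L)
    (hC5 : c5Unif D.d D.L U.a D.mu0sq D.msq U.ε₀ U.r₀ ≤ U.C₅) : B1LowerBound114Model.Inputs D U P :=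
  { K := X.K, hKP := X.hKP, hKε := X.hKε, hstop := X.hstop, ℓ := X.ℓ, p := X.p, S := X.S, h0 := X.h0, hS := X.hS, h360 := X.h360,
    qA := fun ω => qVec P D.mu0sq U.a X.K ω.1, qφ0 := fun ω => qScal D.C D.msq U.a X.K ω.2, V := X.V,
    hqAm := (measurable_qVec D.mu0sq U.a X.K).comp measurable_fst,
    hqφm := (measurable_qScal D.C D.msq U.a X.K).comp measurable_snd,
    ZK := X.ZK, ZK0 := X.ZK0, E₀ := X.E₀, r := U.r₀, hZK := X.hZK, hZK0 := X.hZK0, hr := le_rfl,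
    hE1 := X.hE1, hE2 := X.hE2, hE3 := X.hE3, h369 := X.h369,
    hQ := by
      intro ω hω
      have hL' : 1 < (P.L : ℝ) := by
        rw [hPL]
        exact_mod_cast hL
      have h := forms_bound_of_stop D.C hmu hm U.ha hL' X.hKP U.hε₀ X.hstop (r := U.r₀) ω hω
      refine ⟨h.1, h.2.trans (mul_le_mul_of_nonneg_right ?_ (volT_nonneg P))⟩
      rw [hPd, hPL]
      exact hC5 }

/-- **Per lattice**: the pre-inputs on an admissible lattice give `exp(−E₋|T_ε|) ≦ Z^ε` with the ε-independent `E₋ = U.eMinus D`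
(`B1LowerBound114Model.lowerBound_lattice` on `toInputs`). [cite: Balaban1982Higgs1, Theorem (1.14) p.606; (3.68)–(3.69) p.625] -/
theorem lowerBound_lattice_of_preInputs (D : ModelData) (hm : 0 < D.msq) (hmu : 0 < D.mu0sq) (hL : 1 < D.L) (U : B1LowerBound114Model.Consts)
    (hC5 : c5Unif D.d D.L U.a D.mu0sq D.msq U.ε₀ U.r₀ ≤ U.C₅) {P : HiggsLattice.Params} (hP : D.Admissible P) (X : PreInputs D U P) :
    Real.exp (-(U.eMinus D * volT P)) ≤ D.zRen P :=
  lowerBound_lattice D hm hL U hP (X.toInputs hm hmu hP.1 hP.2.1 hL hC5)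

/-- **Theorem (1.14), lower half, FOR THE MODEL FAMILY, from the pre-inputs**: if every admissible lattice carries the pre-inputs of
Sects. 2–3 (the forms of (3.66) concrete; constants `U` chosen before the lattice with `C₅ ≧ c5Unif`), then `exp(−E₋|T_ε|) ≦ Z^ε` on the
whole concrete cutoff family with ONE constant `E₋ = U.eMinus D` — r14's `B1LowerBound.LowerBoundWith` at r01's `ModelData.cutoffFamily`.
[cite: Balaban1982Higgs1, Theorem (1.14) p.606; (3.68)–(3.69) p.625] -/
theorem lowerBoundWith_cutoffFamily_of_preInputs (D : ModelData) (hm : 0 < D.msq) (hmu : 0 < D.mu0sq) (hL : 1 < D.L)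
    (U : B1LowerBound114Model.Consts) (hC5 : c5Unif D.d D.L U.a D.mu0sq D.msq U.ε₀ U.r₀ ≤ U.C₅)
    (h : ∀ P : HiggsLattice.Params, D.Admissible P → Nonempty (PreInputs D U P)) :
    B1LowerBound.LowerBoundWith D.cutoffFamily (U.eMinus D) :=
  lowerBoundWith_cutoffFamily D hm hL U fun P hP => (h P hP).map fun X => X.toInputs hm hmu hP.1 hP.2.1 hL hC5

/-- *"there exist the constant E₋ independent of ε, T_ε"* with `exp(−E₋|T_ε|) ≦ Z^ε` — `B1LowerBound.LowerBoundPrinted` at the concrete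
family, from the pre-inputs. [cite: Balaban1982Higgs1, Theorem (1.14) p.606] -/
theorem lowerBoundPrinted_cutoffFamily_of_preInputs (D : ModelData) (hm : 0 < D.msq) (hmu : 0 < D.mu0sq) (hL : 1 < D.L)
    (U : B1LowerBound114Model.Consts) (hC5 : c5Unif D.d D.L U.a D.mu0sq D.msq U.ε₀ U.r₀ ≤ U.C₅)
    (h : ∀ P : HiggsLattice.Params, D.Admissible P → Nonempty (PreInputs D U P)) : B1LowerBound.LowerBoundPrinted D.cutoffFamily :=
  ⟨U.eMinus D, lowerBoundWith_cutoffFamily_of_preInputs D hm hmu hL U hC5 h⟩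

/-- r01's `LowerBound114 D` (the lower half of the concrete Theorem `Thm114`, standing hypotheses *"m² > 0, μ₀² > 0"* of p. 605 used) from
the pre-inputs with constants chosen before the lattice. [cite: Balaban1982Higgs1, Theorem (1.14) p.606; (3.68)–(3.69) p.625] -/
theorem lowerBound114_of_preInputs (D : ModelData) (hmu : 0 < D.mu0sq) (hL : 1 < D.L) (U : B1LowerBound114Model.Consts)
    (hC5 : c5Unif D.d D.L U.a D.mu0sq D.msq U.ε₀ U.r₀ ≤ U.C₅)
    (h : ∀ P : HiggsLattice.Params, D.Admissible P → Nonempty (PreInputs D U P)) : LowerBound114 D :=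
  fun _ _ hm _ _ => lowerBoundPrinted_cutoffFamily_of_preInputs D hm hmu hL U hC5 h

end Ledger

end Literature.MathematicalPhysics.QuantumFieldTheory.Balaban1983to89.B1Ineq368QuadForms
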